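import Summits.QuantumFields.YangMills.Theorems.IR.AfPincerUcX
import Summits.QuantumFields.YangMills.Theorems.BalabanLadderIRAfOnsetLatticeAF

/-!
# Crux `IR` (stmt-QuantumFields-19354), slot `af-pincer-Uc`, X-stub `stub_afOnsetUc : AFToOnsetUKPc`:
# the polynomial-onset regime and the reduction of `AFToOnsetUKPc` to super-polynomial onsets (seat ym-19354-afpincer-s2)

Sequel of `Theorems/IR/AfPincerUcX.lean` (§X1–§X4) using the lattice-scale asymptotic-freedom files
`Theorems/BalabanLadderIRAfOnset{PlaquetteMoments,Covariance,LatticeAF}`.  Helper (`--supports stmt-QuantumFields-19354`);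
nothing here closes the stub.

* `afToOnsetUKPc_clause_of_polyOnset` — the X-clause of `AFToOnsetUKPc` at `(G, r, n, ε, δ)` HOLDS on every tail where
  the typical onset grows at most polynomially in the precise sense `b⋆^c(β)⁴ · (1 + log β) ≤ C₀ β`
  (`AfOnset.afToOnset_clause_of_polyOnset`: `|Q2| ≤ K (1 + log β)²/(β² min(s,1)⁸)` from the volume-uniform covariance bound).
* `afToOnsetUKPc_of_polyOnset` — consequently a supplier delivering format Uc with an onset of that size for every
  `(G, r, n, ε, δ)` would settle the X-stub outright (recorded as the exact price; the intended world has `b⋆^c ≍ e^{cβ}`).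
* `afToOnsetUKPc_iff_superpoly_regime` — **`AFToOnsetUKPc` is EQUIVALENT to its restriction to the parameter points where
  `b⋆^c(β)⁴ (1 + log β) / β` is unbounded on every tail**: together with §X1 (bounded onsets) and §X2 (`δ ≥ 1`) this is the
  box of record for the stub — its only open content is the super-polynomial regime, «mixing follows interaction»
  (owner `XT-ANATOMY-g27.md` F1), which is NOT claimed here.

* §X6 (owner `XT-ANATOMY-g27` F1/F3 in Uc currency, def-free): `afToOnsetUKPc_iff_mixingFollowsInteraction` (X ⟺ «eventual
  η-interaction at unit `s` forces `s · b⋆^c(β) < T`»), `onsetInUnits_of_afToOnsetUKPc` (X ⟹ X′: under `LowerBounds`,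
  `a β · b⋆^c(β) < T` eventually — the slot's `fmtOnset_pinned`), and the composition consuming ONLY X′:
  `irCal_of_pincerUc_onsetInUnits`, `ir_of_pincerUc_onsetInUnits` (⊢ `BalabanLadder.IR` by name, hypotheses form).
* §X7 `unit_calibration_of_lowerBounds` — a by-product for the NT side: a positive unit map carrying the floors
  `LowerBounds G r a` satisfies `min(a β, 1)⁸ β² ≤ K (1 + log β)²` for all large `β` (floor `ε ≤ Q2` against the
  weak-coupling ceiling `|Q2| ≤ K (1 + log β)²/(β² min(s,1)⁸)`): NT-calibrated units vanish at least like `(log β/β)^{1/4}`.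

HONEST FRAMING: elementary given the cited files; one open stub of one open gap-crux of a CONDITIONAL chain; not a gap claim.
-/

set_option autoImplicit false

noncomputable section

open Filter Topology MeasureTheory
open scoped SchwartzMap
open Literature.MathematicalPhysics.QuantumFieldTheory Literature.MathematicalPhysics.QuantumLattice
open Summit.QuantumFields.YangMills.Cruxes.OSLegsFromFemtoAndGap.DlrCollarTransfer (GapInUnits LowerBounds Q2)

namespace Summit.QuantumFields.YangMills.Cruxes.IR.AfPincerUc

section XPoly

variable {G : Type} [Group G] [TopologicalSpace G] [IsTopologicalGroup G] [CompactSpace G]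
  [MeasurableSpace G] [BorelSpace G]

/-- **Polynomially growing typical onset ⟹ the X-clause of `AFToOnsetUKPc` at `(G, r, n, ε, δ)`** (for ANY pair of
test functions): if `b⋆^c(β)⁴ · (1 + log β) ≤ C₀ β` for `β ≥ β₀` then for every `η > 0` there are `T, β₁` with
`β ≥ β₁ → s > 0 → T ≤ s · b⋆^c(β) → ∃ᶠ L, |Q2 G r β L s f g| ≤ η` (tree `AfOnset.afToOnset_clause_of_polyOnset`). -/
theorem afToOnsetUKPc_clause_of_polyOnset (r : LatticeRep G) (n : ℕ) (ε δ : ℝ) {C₀ β₀ : ℝ}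
    (hgrowth : ∀ β : ℝ, β₀ ≤ β → ((mixOnsetUc r.ρ β n ε δ : ℕ) : ℝ) ^ 4 * (1 + Real.log β) ≤ C₀ * β)
    (f g : 𝓢((EuclideanSpace ℝ (Fin 4)), ℝ)) {η : ℝ} (hη : 0 < η) :
    ∃ T β₁ : ℝ, ∀ β : ℝ, β₁ ≤ β → ∀ s : ℝ, 0 < s → T ≤ s * ((mixOnsetUc r.ρ β n ε δ : ℕ) : ℝ) →
      ∃ᶠ (L : ℕ) in atTop, |Q2 G r β L s f g| ≤ η :=
  AfOnset.afToOnset_clause_of_polyOnset r (fun β => mixOnsetUc r.ρ β n ε δ) hgrowth f g hη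

omit [MeasurableSpace G] [BorelSpace G] in
/-- **The exact price of the X-stub in onset currency**: if for every `(G, r, n, ε, δ)` (admissible, `δ > 0`) the
typical onset satisfies `b⋆^c(β)⁴ · (1 + log β) ≤ C₀ β` on some tail, then `AFToOnsetUKPc` holds.  (Recorded as a
sufficient condition only: the intended world has `b⋆^c ≍ ξ ≍ e^{cβ}`, where this does not apply.) -/
theorem afToOnsetUKPc_of_polyOnset
    (h : ∀ (G : Type) [Group G] [TopologicalSpace G] [IsTopologicalGroup G] [CompactSpace G],
      IsCompactSimpleLieGroup G → letI : MeasurableSpace G := borel G; haveI : BorelSpace G := ⟨rfl⟩;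
      ∀ (r : LatticeRep G) (n : ℕ) (ε : ℝ), 1 ≤ n → 0 ≤ ε → ε * OnsetFormats.shellCount n ≤ 3 / 4 →
        ∀ δ : ℝ, 0 < δ → ∃ C₀ β₀ : ℝ, ∀ β : ℝ, β₀ ≤ β →
          ((mixOnsetUc r.ρ β n ε δ : ℕ) : ℝ) ^ 4 * (1 + Real.log β) ≤ C₀ * β) :
    AFToOnsetUKPc := by
  intro G _ _ _ _ hG
  letI : MeasurableSpace G := borel G
  haveI : BorelSpace G := ⟨rfl⟩
  intro r n ε hn hε hM δ hδ v _ η hη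
  obtain ⟨C₀, β₀, hgrowth⟩ := h G hG r n ε hn hε hM δ hδ
  exact afToOnsetUKPc_clause_of_polyOnset r n ε δ hgrowth (thetaTest 4 v) v hη

omit [MeasurableSpace G] [BorelSpace G] in
/-- **`AFToOnsetUKPc` reduces to the super-polynomial-onset regime**: the registered statement is EQUIVALENT to the
same statement asked only at the parameter points `(G, r, n, ε, δ)` where `b⋆^c(β)⁴ (1 + log β) / β` is unbounded on
every tail (`∀ C₀ β₀, ∃ β ≥ β₀, C₀ β < b⋆^c(β)⁴ (1 + log β)`); at all other points the X-clause holds by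
`afToOnsetUKPc_clause_of_polyOnset`.  This sharpens `afToOnsetUKPc_iff_unbounded_regime` (§X1). -/
theorem afToOnsetUKPc_iff_superpoly_regime :
    AFToOnsetUKPc ↔
    ∀ (G : Type) [Group G] [TopologicalSpace G] [IsTopologicalGroup G] [CompactSpace G],
      IsCompactSimpleLieGroup G → letI : MeasurableSpace G := borel G; haveI : BorelSpace G := ⟨rfl⟩;
      ∀ (r : LatticeRep G) (n : ℕ) (ε : ℝ), 1 ≤ n → 0 ≤ ε → ε * OnsetFormats.shellCount n ≤ 3 / 4 →
        ∀ δ : ℝ, 0 < δ →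
        (∀ (C₀ β₀ : ℝ), ∃ β : ℝ, β₀ ≤ β ∧
          C₀ * β < ((mixOnsetUc r.ρ β n ε δ : ℕ) : ℝ) ^ 4 * (1 + Real.log β)) →
        ∀ v : 𝓢(EuclideanSpace ℝ (Fin 4), ℝ), tsupport v ⊆ {y : EuclideanSpace ℝ (Fin 4) | 0 < y 0} →
          ∀ η : ℝ, 0 < η → ∃ T β₁ : ℝ, ∀ β : ℝ, β₁ ≤ β → ∀ s : ℝ, 0 < s →
            T ≤ s * (mixOnsetUc r.ρ β n ε δ : ℝ) →
              ∃ᶠ (L : ℕ) in atTop, |Q2 G r β L s (thetaTest 4 v) v| ≤ η := by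
  constructor
  · intro h G _ _ _ _ hG
    letI : MeasurableSpace G := borel G
    haveI : BorelSpace G := ⟨rfl⟩
    intro r n ε hn hε hM δ hδ _ v hv η hη
    exact h G hG r n ε hn hε hM δ hδ v hv η hη
  · intro h G _ _ _ _ hG
    letI : MeasurableSpace G := borel G
    haveI : BorelSpace G := ⟨rfl⟩
    intro r n ε hn hε hM δ hδ v hv η hη
    by_cases hb : ∃ (C₀ β₀ : ℝ), ∀ β : ℝ, β₀ ≤ β →
        ((mixOnsetUc r.ρ β n ε δ : ℕ) : ℝ) ^ 4 * (1 + Real.log β) ≤ C₀ * β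
    · obtain ⟨C₀, β₀, hgrowth⟩ := hb
      exact afToOnsetUKPc_clause_of_polyOnset r n ε δ hgrowth (thetaTest 4 v) v hη
    · push Not at hb
      exact h G hG r n ε hn hε hM δ hδ hb v hv η hη

end XPoly

section XPrime

variable {G : Type} [Group G] [TopologicalSpace G] [IsTopologicalGroup G] [CompactSpace G]
  [MeasurableSpace G] [BorelSpace G]

omit [MeasurableSpace G] [BorelSpace G] in
/-- **X^{Uc} ⟺ «mixing follows interaction»** (owner `XT-ANATOMY-g27` F1, Uc currency, def-free): for every test
function and `η > 0` there are `T, β₁` such that for `β ≥ β₁` and every unit `s > 0`, EVENTUAL `η`-interaction at unit `s`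
(`η < |Q2|` on all large tori) forces `s · b⋆^c(β) < T`.  Contraposition unit by unit. -/
theorem afToOnsetUKPc_iff_mixingFollowsInteraction :
    AFToOnsetUKPc ↔
    ∀ (G : Type) [Group G] [TopologicalSpace G] [IsTopologicalGroup G] [CompactSpace G],
      IsCompactSimpleLieGroup G → letI : MeasurableSpace G := borel G; haveI : BorelSpace G := ⟨rfl⟩;
      ∀ (r : LatticeRep G) (n : ℕ) (ε : ℝ), 1 ≤ n → 0 ≤ ε → ε * OnsetFormats.shellCount n ≤ 3 / 4 → ∀ δ : ℝ, 0 < δ →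
        ∀ v : 𝓢(EuclideanSpace ℝ (Fin 4), ℝ), tsupport v ⊆ {y : EuclideanSpace ℝ (Fin 4) | 0 < y 0} →
          ∀ η : ℝ, 0 < η → ∃ T β₁ : ℝ, ∀ β : ℝ, β₁ ≤ β → ∀ s : ℝ, 0 < s →
            (∀ᶠ (L : ℕ) in atTop, η < |Q2 G r β L s (thetaTest 4 v) v|) →
              s * (mixOnsetUc r.ρ β n ε δ : ℝ) < T := by
  constructor
  · intro h G _ _ _ _ hG
    letI : MeasurableSpace G := borel G
    haveI : BorelSpace G := ⟨rfl⟩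
    intro r n ε hn hε hM δ hδ v hv η hη
    obtain ⟨T, β₁, hT⟩ := h G hG r n ε hn hε hM δ hδ v hv η hη
    refine ⟨T, β₁, fun β hβ s hs hev => ?_⟩
    by_contra hge
    rw [not_lt] at hge
    have hfreq := hT β hβ s hs hge
    obtain ⟨L, hL1, hL2⟩ := (hfreq.and_eventually hev).exists
    linarith
  · intro h G _ _ _ _ hG
    letI : MeasurableSpace G := borel G
    haveI : BorelSpace G := ⟨rfl⟩
    intro r n ε hn hε hM δ hδ v hv η hη
    obtain ⟨T, β₁, hT⟩ := h G hG r n ε hn hε hM δ hδ v hv η hη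
    refine ⟨T, β₁, fun β hβ s hs hTs => ?_⟩
    by_contra hnot
    have hev : ∀ᶠ (L : ℕ) in atTop, η < |Q2 G r β L s (thetaTest 4 v) v| := by
      rw [Filter.not_frequently] at hnot
      exact hnot.mono fun L hL => not_le.mp hL
    have hlt := hT β hβ s hs hev
    linarith

omit [MeasurableSpace G] [BorelSpace G] in
/-- **X^{Uc} ⟹ X′^{Uc} (onset in units)** (owner F3, Uc currency): for every compact simple `G`, every `r`, every
positive unit map `a` carrying the floors `LowerBounds G r a`, every admissible `(n, ε)` and every `δ > 0`:
`a β · b⋆^c(β) < T` for all `β ≥ β₆` — the slot's generic pincer `fmtOnset_pinned`; this is ALL the composition consumes. -/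
theorem onsetInUnits_of_afToOnsetUKPc (hX : AFToOnsetUKPc) :
    ∀ (G : Type) [Group G] [TopologicalSpace G] [IsTopologicalGroup G] [CompactSpace G],
      IsCompactSimpleLieGroup G → letI : MeasurableSpace G := borel G; haveI : BorelSpace G := ⟨rfl⟩;
      ∀ (r : LatticeRep G) (a : ℝ → ℝ), (∀ β, 0 < a β) → LowerBounds G r a →
        ∀ (n : ℕ) (ε : ℝ), 1 ≤ n → 0 ≤ ε → ε * OnsetFormats.shellCount n ≤ 3 / 4 → ∀ δ : ℝ, 0 < δ →
          ∃ T β₆ : ℝ, ∀ β : ℝ, β₆ ≤ β → a β * (mixOnsetUc r.ρ β n ε δ : ℝ) < T := by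
  intro G _ _ _ _ hG
  letI : MeasurableSpace G := borel G
  haveI : BorelSpace G := ⟨rfl⟩
  intro r a ha hlb n ε hn hε hM δ hδ
  exact fmtOnset_pinned (fun β' b => TypShellCondUKPc r.ρ β' b n ε δ) r a ha hlb (hX G hG r n ε hn hε hM δ hδ)

omit [MeasurableSpace G] [BorelSpace G] in
/-- **Composition with X′ in place of X (real proof): `E^c → I^c → X′^c → IRCal`** — the route's conclusion needs from the
X-side only the pinning `a β · b⋆^c(β) < T` at the `(n, ε)` of I^c and the `δ₀` of E^c (hypotheses form; nothing asserted). -/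
theorem irCal_of_pincerUc_onsetInUnits (hE : TypCriterionUKPc) (hI : OnsetMixingTypicalUKPc)
    (hX' : ∀ (G : Type) [Group G] [TopologicalSpace G] [IsTopologicalGroup G] [CompactSpace G],
      IsCompactSimpleLieGroup G → letI : MeasurableSpace G := borel G; haveI : BorelSpace G := ⟨rfl⟩;
      ∀ (r : LatticeRep G) (a : ℝ → ℝ), (∀ β, 0 < a β) → LowerBounds G r a →
        ∀ (n : ℕ) (ε : ℝ), 1 ≤ n → 0 ≤ ε → ε * OnsetFormats.shellCount n ≤ 3 / 4 → ∀ δ : ℝ, 0 < δ →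
          ∃ T β₆ : ℝ, ∀ β : ℝ, β₆ ≤ β → a β * (mixOnsetUc r.ρ β n ε δ : ℝ) < T) :
    IRCal := by
  intro G _ _ _ _ hG
  letI : MeasurableSpace G := borel G
  haveI : BorelSpace G := ⟨rfl⟩
  intro r a ha _ hlb
  obtain ⟨n, ε, hn, hε, hM, hIδ⟩ := hI G hG r
  obtain ⟨δ₀, κ, s₀, hδ₀, hκ, hcl⟩ := fmtClustering_of_typCriterionUKPc hE r hn hε hM
  obtain ⟨β₂, hon⟩ := hIδ δ₀ hδ₀
  obtain ⟨T, β₆, hpin⟩ := hX' G hG r a ha hlb n ε hn hε hM δ₀ hδ₀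
  exact gapInUnits_of_fmtOnset r a ha hκ hcl
    (fun β hβ => by obtain ⟨b, hb, hP⟩ := hon β hβ; exact ⟨b, hb, hP⟩) hpin

omit [MeasurableSpace G] [BorelSpace G] in
/-- The X′ cut concludes the ROUTE DECL by name (hypotheses form; nothing registered). -/
theorem ir_of_pincerUc_onsetInUnits (hE : TypCriterionUKPc) (hI : OnsetMixingTypicalUKPc)
    (hX' : ∀ (G : Type) [Group G] [TopologicalSpace G] [IsTopologicalGroup G] [CompactSpace G],
      IsCompactSimpleLieGroup G → letI : MeasurableSpace G := borel G; haveI : BorelSpace G := ⟨rfl⟩;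
      ∀ (r : LatticeRep G) (a : ℝ → ℝ), (∀ β, 0 < a β) → LowerBounds G r a →
        ∀ (n : ℕ) (ε : ℝ), 1 ≤ n → 0 ≤ ε → ε * OnsetFormats.shellCount n ≤ 3 / 4 → ∀ δ : ℝ, 0 < δ →
          ∃ T β₆ : ℝ, ∀ β : ℝ, β₆ ≤ β → a β * (mixOnsetUc r.ρ β n ε δ : ℝ) < T) :
    Summit.QuantumFields.YangMills.Theses.BalabanLadder.IR := by
  have h : IRCal := irCal_of_pincerUc_onsetInUnits hE hI hX'
  delta Summit.QuantumFields.YangMills.Theses.BalabanLadder.IR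
  delta Summit.QuantumFields.YangMills.Cruxes.IR.AfPincerUc.IRCal at h
  exact h

end XPrime

section Calibration

variable {G : Type} [Group G] [TopologicalSpace G] [IsTopologicalGroup G] [CompactSpace G]
  [MeasurableSpace G] [BorelSpace G]

/-- **Unit calibration forced by the floors.**  If a positive unit map `a` carries the non-triviality floors
`LowerBounds G r a` (clause (i): `ε ≤ Q2 G r β L (a β) (θv) v` on all large tori at all large `β`), then for all large
`β`: `min(a β, 1)⁸ · β² ≤ K (1 + log β)²` — the floor against the weak-coupling ceiling
`AfOnset.exists_abs_Q2_le_log_sq`.  So NT-calibrated units vanish at least like `(log β/β)^{1/4}`; equivalently the crux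
`IR` (`LowerBounds → GapInUnits`) is vacuous for every slower unit map. [folklore] -/
theorem unit_calibration_of_lowerBounds (r : LatticeRep G) (a : ℝ → ℝ) (ha : ∀ β, 0 < a β)
    (hlb : LowerBounds G r a) :
    ∃ K β₁ : ℝ, 0 ≤ K ∧ ∀ β : ℝ, β₁ ≤ β → (min (a β) 1) ^ 8 * β ^ 2 ≤ K * (1 + Real.log β) ^ 2 := by
  obtain ⟨⟨v, ε, β₅, Λ₅, _, hε, hfloor⟩, -⟩ := hlb
  obtain ⟨K, hK0, hK⟩ := AfOnset.exists_abs_Q2_le_log_sq r (thetaTest 4 v) v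
  refine ⟨K / ε, max β₅ 1, div_nonneg hK0 hε.le, fun β hβ => ?_⟩
  have hβ5 : β₅ ≤ β := le_trans (le_max_left _ _) hβ
  have hβ1 : 1 ≤ β := le_trans (le_max_right _ _) hβ
  have hβ0 : 0 < β := lt_of_lt_of_le one_pos hβ1
  have ha0 := ha β
  -- a torus large enough for the floor
  set L : ℕ := ⌈Λ₅ / a β⌉₊ + 1 with hL
  have hL1 : 1 ≤ L := by omega
  have hΛ : Λ₅ ≤ a β * (L : ℝ) := by
    have h1 : Λ₅ / a β ≤ (⌈Λ₅ / a β⌉₊ : ℝ) := Nat.le_ceil _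
    have h2 : (⌈Λ₅ / a β⌉₊ : ℝ) ≤ (L : ℝ) := by
      rw [hL]; push_cast; linarith
    have h3 : Λ₅ / a β ≤ (L : ℝ) := h1.trans h2
    rw [div_le_iff₀ ha0] at h3
    linarith [mul_comm (L : ℝ) (a β)]
  have hlo := hfloor β hβ5 L hΛ
  have hup := hK L hL1 β hβ1 (a β) ha0
  have hm0 : 0 < min (a β) 1 := lt_min ha0 one_pos
  have hden : 0 < β ^ 2 * (min (a β) 1) ^ 8 := by positivity
  have h1 : ε ≤ K * (1 + Real.log β) ^ 2 / (β ^ 2 * (min (a β) 1) ^ 8) :=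
    hlo.trans ((le_abs_self _).trans hup)
  rw [le_div_iff₀ hden] at h1
  rw [div_mul_eq_mul_div, le_div_iff₀ hε]
  linarith [mul_comm ε (β ^ 2 * (min (a β) 1) ^ 8)]

end Calibration

end Summit.QuantumFields.YangMills.Cruxes.IR.AfPincerUc

end
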